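import Summits.MatrixMultiplication.MatrixMultiplication.Theorems.AbelianSTPPCensusShapeCertVQKGSemantics
import Summits.MatrixMultiplication.MatrixMultiplication.Theorems.AbelianSTPPCensusShapeCertVQKSearch

/-!
# Abelian STPP census — soundness of `ShapeCertVQ.checkQKG`, part 2: the search; `checkQKG_sound`

Cell mm-stpp, rung F-M1; census-silent kernel ENABLER for the tranche-2 device band on `T_E` (vQKG := vP ∧ E3⁺ ∧ E3K ∧ U11-G′), in support
of the closed crux item stmt-MatrixMultiplication-19191; seat mm-stpp-vp-p2 (gen 9).  The search induction of vp-p2 g3's `…ShapeCertVQKSearch`,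
VERBATIM, for the goal `GoalKG` (g3's `GoalK` with rule U11-G′ in credit form, `AdmGW M G` of `…VQKGSemantics`, as one more standing
hypothesis, threaded unchanged through step and walks) and the node logic `dfsKG` of `…VQKGDefs` (one more kill, `killEKG`, sound by
`AboveQ.false_of_killEKG`):
* `stepKG_sound`, `innerKG_sound`, `loopKG_sound` — g3's `stepK_sound` / `innerK_sound` / `loopK_sound` for `GoalKG` (the functions
  `stepS` / `innerS` / `loopS` are g2's; every bound used is an `AboveQ` fact of g1/g2; the in-step U11-G kill `killV` and the Grynkiewicz
  budgets stay the trio's);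
* `dfsKG_sound`, **`checkQKG_sound`**: if `checkQKG M = true` (`M ≤ 489`) then no shape multiset inside the universe of order `M`
  satisfying `AdmM`, `AdmG`, `AdmE`, `AdmK` and `AdmGW` has integer gain above `10⁶·M`.
Part 3 (`…ShapeCertVQKGSearchP`): path segments.  Bridge: `…ShapeCertVQKGFinal`.
WHAT THIS IS NOT: no statement about STPP families or `ω` by itself; no census number.
-/

set_option linter.dupNamespace false -- `MatrixMultiplication.MatrixMultiplication` (summit = problem, D-0017)
set_option autoImplicit false

namespace Summit.MatrixMultiplication.MatrixMultiplication.Theorems.ShapeCertVQ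

open ShapeCert ShapeCertVP STPPThreeRoomEnergy Multiset


section searchKG
/-! ### The search induction -/

variable {M : ℕ}

/-- **Soundness of one candidate step** (g3's `stepK_sound` with the U11-G′ hypothesis threaded to the recursion). -/
theorem stepKG_sound {rec : List Sh → List (List Sh) → Bool} {t : Sh} {fam r : List Sh} {bs : List (List Sh)}
    (IH : ∀ fam' B', WfQ M fam' → PoolOKQ M B'.flatten → (∀ b ∈ B', ∀ s ∈ b, ∀ s' ∈ b, s.lev = s'.lev) →
      (fam' ≠ [] → ∀ s ∈ B'.flatten, s.lev ≤ headLevQ fam') → rec fam' B' = true → GoalKG M fam' B'.flatten)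
    (hwf : WfQ M fam) (hP : PoolOKQ M (t :: (r ++ bs.flatten)))
    (hB : ∀ b ∈ (t :: r) :: bs, ∀ s ∈ b, ∀ s' ∈ b, s.lev = s'.lev) {q : ℕ}
    (hstep : stepS M rec t (aggOf M fam) fam ((aggOf M fam).gs * K) q (selOf ((aggOf M fam).kOf M)) (M * D * K) r bs = true)
    {G : Multiset (ℕ × ℕ × ℕ)} (hG : AboveQ M G fam) (hK : AdmK M G) (hW : AdmGW M G) (hq : ((G - famT fam).map uu).sum ≤ q)
    (hbeat : M * D < gsumQ G)
    (hpool : ∀ x ∈ G - famT fam, levTQ x ≤ loLev ∨ shQ M x ∈ t :: (r ++ bs.flatten)) (hx : t.tr ∈ G - famT fam) : False := by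
  have hwt : t = shQ M t.tr := hP.wf t (by simp)
  have hL : ∀ x ∈ G - famT fam, levTQ x ≤ loLev ∨ levTQ x ≤ t.lev := by
    intro x hx'
    rcases hpool x hx' with h | h
    · exact Or.inl h
    · right
      rcases List.mem_cons.mp h with h | h
      · rw [← shQ_lev M x, h]
      · have := List.rel_of_pairwise_cons hP.sorted h
        rw [← shQ_lev M x]; exact this
  -- the child's tail mass
  have hut : t.ab + t.bc + t.ca = uu t.tr := by rw [hwt]; simp [uu]
  have hq1 : ((G - famT (t :: fam)).map uu).sum ≤ q - (t.ab + t.bc + t.ca) := by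
    rw [tail_uu_cons hx, hut]; exact Nat.sub_le_sub_right hq _
  unfold stepS at hstep
  rw [aggOf_gs, seqN_eq] at hstep
  by_cases hpre : gs fam * K + t.g * K + selOf ((aggOf M fam).kOf M) (tabRQ t.lev) *
      min (q - (t.ab + t.bc + t.ca)) ((3 * M + (t.a + t.b + t.c)) / 2 - uuA (aggOf M fam) - (t.ab + t.bc + t.ca)) ≤ M * D * K
  · exact hG.not_beat_of_first_S hx hwt hL hq1 hpre hbeat
  rw [if_neg hpre, Agg.force_eq] at hstep
  have hwf1 : WfQ M (t :: fam) := by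
    intro s hs; rcases List.mem_cons.mp hs with rfl | hs
    · exact hwt
    · exact hwf s hs
  have hle1 : famT (t :: fam) ≤ G := cons_le_of_mem_sub hG.le hx
  have hG1 : AboveQ M G (t :: fam) := ⟨hG.hM, hG.univ, hG.adm, hG.admG, hG.admE, hwf1, hle1⟩
  have hpool1 : ∀ x ∈ G - famT (t :: fam), levTQ x ≤ loLev ∨ shQ M x ∈ t :: (r ++ bs.flatten) :=
    fun x hx' => hpool x (Multiset.mem_of_le (sub_cons_le _ _ _) hx')
  have hL1 : ∀ x ∈ G - famT (t :: fam), levTQ x ≤ loLev ∨ levTQ x ≤ t.lev :=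
    fun x hx' => hL x (Multiset.mem_of_le (sub_cons_le _ _ _) hx')
  by_cases hpr : ((aggOf M fam).push t).prune M (tabRQ t.lev) = true
  · rw [← aggOf_cons] at hpr
    have hp := prune_sound hpr
    rw [aggOf_gs] at hp
    exact hG1.not_beat_of_R hL1 hp hbeat
  rw [if_neg hpr] at hstep
  by_cases hbud : ((aggOf M fam).push t).gs * K + (tabRQ t.lev).get (((aggOf M fam).push t).kOf M) *
      min (q - (t.ab + t.bc + t.ca)) (qOfS M ((aggOf M fam).push t) (t :: fam)) ≤ M * D * K
  · rw [← aggOf_cons, aggOf_gs] at hbud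
    exact hG1.not_beat_of_Rq hL1 (le_min hq1 hG1.tail_uu_le_qOfS) hbud hbeat
  rw [if_neg hbud] at hstep
  have hF : AboveQ M (famT (t :: fam)) (t :: fam) :=
    ⟨hG.hM, fun x hx' => hG.univ x (Multiset.mem_of_le hle1 hx'), hG.adm.mono hle1, hG.admG.mono hle1,
      hG.admE.mono hG.univ hle1, hwf1, le_rfl⟩
  rw [feasP_completeQ hF rfl, if_pos rfl] at hstep
  by_cases hk : killV M ((aggOf M fam).push t) (t :: fam) = true
  · rw [← aggOf_cons] at hk
    exact not_admG_of_killVQ hwf1 hk (hG.admG.mono hle1)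
  rw [if_neg hk] at hstep
  have hflat : ((t :: r) :: bs).flatten = t :: (r ++ bs.flatten) := by simp
  exact IH (t :: fam) ((t :: r) :: bs) hwf1 (by rw [hflat]; exact hP) hB (fun _ s hs => by
    rw [hflat] at hs
    rcases List.mem_cons.mp hs with rfl | hs
    · exact le_rfl
    · exact List.rel_of_pairwise_cons hP.sorted hs) hstep G hG1 hK hW hbeat (by rw [hflat]; exact hpool1)

/-- **Soundness of the walk inside one block** (continuation `k` for the lower blocks `bs`; g3's `innerK_sound`). -/
theorem innerKG_sound {rec : List Sh → List (List Sh) → Bool} {fam : List Sh} {bs : List (List Sh)}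
    (IH : ∀ fam' B', WfQ M fam' → PoolOKQ M B'.flatten → (∀ b ∈ B', ∀ s ∈ b, ∀ s' ∈ b, s.lev = s'.lev) →
      (fam' ≠ [] → ∀ s ∈ B'.flatten, s.lev ≤ headLevQ fam') → rec fam' B' = true → GoalKG M fam' B'.flatten)
    (hwf : WfQ M fam) (hBs : ∀ b ∈ bs, ∀ s ∈ b, ∀ s' ∈ b, s.lev = s'.lev) {q : ℕ}
    (hq : ∀ G, AboveQ M G fam → ((G - famT fam).map uu).sum ≤ q)
    {lb1 : ℕ} (hlb : lb1 ≠ 0 → loLev ≤ lb1 - 1 ∧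
      ((aggOf M fam).gs * K + (tabRQ (lb1 - 1)).get ((aggOf M fam).kOf M) * q ≤ M * D * K ∨
       ∃ i b, (budsOf M (aggOf M fam) fam).get i = some b ∧
         (aggOf M fam).gs * K + b * (tabGQ (lb1 - 1)).get i ≤ M * D * K))
    {k : Bool} (hk : k = true → GoalKG M fam bs.flatten) :
    ∀ b : List Sh, PoolOKQ M (b ++ bs.flatten) → (∀ s ∈ b, ∀ s' ∈ b, s.lev = s'.lev) →
      innerS M rec fam (aggOf M fam) ((aggOf M fam).ra M) ((aggOf M fam).rb M) ((aggOf M fam).rc M)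
        ((aggOf M fam).vl M) ((aggOf M fam).gs * K) q (selOf ((aggOf M fam).kOf M)) (M * D * K) lb1 k bs b = true →
      GoalKG M fam (b ++ bs.flatten)
  | [], _, _, h => by rw [innerS] at h; simpa using hk h
  | t :: r, hP, hb, h => by
    intro G hG hK hW hbeat hpool
    rw [innerS] at h
    by_cases hbr : t.lev < lb1
    · obtain ⟨hlo, hbd⟩ := hlb (by omega)
      have hL : ∀ x ∈ G - famT fam, levTQ x ≤ loLev ∨ levTQ x ≤ lb1 - 1 := by
        intro x hx
        rcases hpool x hx with h' | h'
        · exact Or.inl h'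
        · right
          have : (shQ M x).lev ≤ t.lev := by
            rcases List.mem_cons.mp h' with h' | h'
            · rw [h']
            · exact List.rel_of_pairwise_cons hP.sorted h'
          rw [shQ_lev] at this; omega
      rcases hbd with hbd | ⟨i, b', hbi, hle⟩
      · exact hG.not_beat_of_Rq hL (hq G hG) (by simpa only [aggOf_gs] using hbd) hbeat
      · exact hG.not_beat_of_G hbi hL (by simpa only [aggOf_gs] using hle) hbeat
    rw [if_neg hbr] at h
    have hpool' : t.tr ∉ G - famT fam → ∀ x ∈ G - famT fam, levTQ x ≤ loLev ∨ shQ M x ∈ r ++ bs.flatten := by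
      intro ht x hx
      rcases hpool x hx with h' | h'
      · exact Or.inl h'
      · rcases List.mem_cons.mp h' with he | he
        · exfalso; apply ht; rw [← he, shQ_tr]; exact hx
        · exact Or.inr he
    have hb' : ∀ s ∈ r, ∀ s' ∈ r, s.lev = s'.lev :=
      fun s hs s' hs' => hb s (List.mem_cons_of_mem _ hs) s' (List.mem_cons_of_mem _ hs')
    by_cases hsk : skipS t ((aggOf M fam).ra M) ((aggOf M fam).rb M) ((aggOf M fam).rc M) ((aggOf M fam).vl M) q = true
    · rw [if_pos hsk] at h
      exact innerKG_sound IH hwf hBs hq hlb hk r hP.tail hb' h G hG hK hW hbeat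
        (hpool' (hG.not_mem_of_skipS (hP.wf t (by simp)) (hq G hG) hsk))
    rw [if_neg hsk, Bool.and_eq_true] at h
    obtain ⟨hstep, hrest⟩ := h
    by_cases hx : t.tr ∈ G - famT fam
    · have hB : ∀ b ∈ (t :: r) :: bs, ∀ s ∈ b, ∀ s' ∈ b, s.lev = s'.lev := by
        intro b hb'' ; rcases List.mem_cons.mp hb'' with rfl | hb''
        · exact hb
        · exact hBs b hb''
      exact stepKG_sound IH hwf hP hB hstep hG hK hW (hq G hG) hbeat hpool hx
    · exact innerKG_sound IH hwf hBs hq hlb hk r hP.tail hb' hrest G hG hK hW hbeat (hpool' hx)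

/-- **Soundness of the walk over the blocks** (g3's `loopK_sound`). -/
theorem loopKG_sound {rec : List Sh → List (List Sh) → Bool} {fam : List Sh}
    (IH : ∀ fam' B', WfQ M fam' → PoolOKQ M B'.flatten → (∀ b ∈ B', ∀ s ∈ b, ∀ s' ∈ b, s.lev = s'.lev) →
      (fam' ≠ [] → ∀ s ∈ B'.flatten, s.lev ≤ headLevQ fam') → rec fam' B' = true → GoalKG M fam' B'.flatten)
    (hwf : WfQ M fam) (hM : M ≤ 489) {q : ℕ}
    (hq : ∀ G, AboveQ M G fam → ((G - famT fam).map uu).sum ≤ q)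
    {lb1 : ℕ} (hlb : lb1 ≠ 0 → loLev ≤ lb1 - 1 ∧
      ((aggOf M fam).gs * K + (tabRQ (lb1 - 1)).get ((aggOf M fam).kOf M) * q ≤ M * D * K ∨
       ∃ i b, (budsOf M (aggOf M fam) fam).get i = some b ∧
         (aggOf M fam).gs * K + b * (tabGQ (lb1 - 1)).get i ≤ M * D * K))
    {lc : ℕ} (hlc : ∀ G, AboveQ M G fam → ∀ x ∈ G - famT fam, levTQ x < lc)
    {cl : Bool} (hcl : cl = true → fam = [] ∨ (aggOf M fam).gs * K + (tabRQ loLev).get ((aggOf M fam).kOf M) * q ≤ M * D * K ∨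
       ∃ i b, (budsOf M (aggOf M fam) fam).get i = some b ∧ (aggOf M fam).gs * K + b * (tabGQ loLev).get i ≤ M * D * K) :
    ∀ B : List (List Sh), PoolOKQ M B.flatten → (∀ b ∈ B, ∀ s ∈ b, ∀ s' ∈ b, s.lev = s'.lev) →
      loopS M rec fam (aggOf M fam) ((aggOf M fam).ra M) ((aggOf M fam).rb M) ((aggOf M fam).rc M)
        ((aggOf M fam).vl M) ((aggOf M fam).gs * K) q (selOf ((aggOf M fam).kOf M)) (M * D * K) lb1 lc cl B = true →
      GoalKG M fam B.flatten
  | [], _, _, hloop => by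
    intro G hG hK hW hbeat hpool
    rw [loopS] at hloop
    have hlow : ∀ x ∈ G - famT fam, levTQ x ≤ loLev := fun x hx => by
      rcases hpool x hx with h | h
      · exact h
      · simp at h
    rcases hcl hloop with h | h | ⟨i, b, hb, hle⟩
    · subst h
      have : G - famT [] = G := by simp [famT]
      rw [this] at hlow
      exact gsum_le_of_lowQ hM hG.univ hG.adm hlow hbeat
    · exact hG.not_beat_of_Rq (L := loLev) (fun x hx => Or.inl (hlow x hx)) (hq G hG) (by simpa only [aggOf_gs] using h) hbeat
    · exact hG.not_beat_of_G hb (L := loLev) (fun x hx => Or.inl (hlow x hx)) (by simpa only [aggOf_gs] using hle) hbeat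
  | b :: bs, hP, hB, hloop => by
    have hBs : ∀ b' ∈ bs, ∀ s ∈ b', ∀ s' ∈ b', s.lev = s'.lev := fun b' hb' => hB b' (List.mem_cons_of_mem _ hb')
    have hb : ∀ s ∈ b, ∀ s' ∈ b, s.lev = s'.lev := hB b (by simp)
    have hflat : (b :: bs).flatten = b ++ bs.flatten := List.flatten_cons
    rw [hflat] at hP ⊢
    cases b with
    | nil =>
      rw [loopS] at hloop
      rw [List.nil_append]
      exact loopKG_sound IH hwf hM hq hlb hlc hcl bs hP.dropBlock hBs hloop
    | cons t r =>
      rw [loopS] at hloop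
      intro G hG hK hW hbeat hpool
      by_cases hbr : t.lev < lb1
      · obtain ⟨hlo, hbd⟩ := hlb (by omega)
        have hL : ∀ x ∈ G - famT fam, levTQ x ≤ loLev ∨ levTQ x ≤ lb1 - 1 := by
          intro x hx
          rcases hpool x hx with h' | h'
          · exact Or.inl h'
          · right
            have : (shQ M x).lev ≤ t.lev := by
              rcases List.mem_cons.mp h' with h' | h'
              · rw [h']
              · exact List.rel_of_pairwise_cons hP.sorted h'
            rw [shQ_lev] at this; omega
        rcases hbd with hbd | ⟨i, b', hbi, hle⟩
        · exact hG.not_beat_of_Rq hL (hq G hG) (by simpa only [aggOf_gs] using hbd) hbeat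
        · exact hG.not_beat_of_G hbi hL (by simpa only [aggOf_gs] using hle) hbeat
      rw [if_neg hbr] at hloop
      by_cases hcap : lc ≤ t.lev
      · -- the whole block lies at or above the level cap: it holds no tail member
        rw [if_pos hcap] at hloop
        refine loopKG_sound IH hwf hM hq hlb hlc hcl bs hP.dropBlock hBs hloop G hG hK hW hbeat ?_
        intro x hx
        rcases hpool x hx with h' | h'
        · exact Or.inl h'
        · rcases List.mem_append.mp h' with h' | h'
          · exfalso
            have h1 := hlc G hG x hx
            have h2 : (shQ M x).lev = t.lev := hb _ h' t (by simp)
            rw [shQ_lev] at h2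
            omega
          · exact Or.inr h'
      · rw [if_neg hcap] at hloop
        exact innerKG_sound IH hwf hBs hq hlb (fun hk => loopKG_sound IH hwf hM hq hlb hlc hcl bs hP.dropBlock hBs hk)
          (t :: r) hP hb hloop G hG hK hW hbeat hpool

/-- **Soundness of the search `dfsKG`** (induction on the fuel; g3's `dfsK_sound` with the node kill `killEKG`, sound by
`AboveQ.false_of_killEKG`). -/
theorem dfsKG_sound (hM : M ≤ 489) : ∀ (n : ℕ) (fam : List Sh) (B : List (List Sh)), WfQ M fam → PoolOKQ M B.flatten →
    (∀ b ∈ B, ∀ s ∈ b, ∀ s' ∈ b, s.lev = s'.lev) → (fam ≠ [] → ∀ s ∈ B.flatten, s.lev ≤ headLevQ fam) →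
    dfsKG M (divsQ M) n fam B = true → GoalKG M fam B.flatten
  | 0, fam, B, _, _, _, _, h => by simp [dfsKG] at h
  | n + 1, fam, B, hwf, hP, hB, hhead, h => by
    simp only [dfsKG, Agg.force_eq, seqN_eq] at h
    intro G hG hK hW hbeat hpool
    by_cases hk : killEKG (divsQ M) M (aggOf M fam) fam = true
    · exact hG.false_of_killEKG hK hW hk
    rw [if_neg hk] at h
    by_cases hb : M * D < (aggOf M fam).gs
    · rw [if_pos hb] at h; exact Bool.false_ne_true h
    rw [if_neg hb] at h
    by_cases hd : (aggOf M fam).dead M = true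
    · have h0 := hG.tail_eq_zero_of_dead hd
      rw [hG.gsum_split, h0] at hbeat; simp [gsumQ] at hbeat; rw [aggOf_gs] at hb; omega
    rw [if_neg hd] at h
    have hL : fam ≠ [] → ∀ x ∈ G - famT fam, levTQ x ≤ loLev ∨ levTQ x ≤ headLevQ fam := by
      intro hf x hx
      rcases hpool x hx with h' | h'
      · exact Or.inl h'
      · right; rw [← shQ_lev M x]; exact hhead hf _ h'
    by_cases hte : (budsOf M (aggOf M fam) fam).tailEmpty = true
    · rw [if_pos hte, decide_eq_true_eq] at h
      obtain ⟨i, b, hbi, hsmall⟩ := tailEmpty_spec hte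
      exact hG.not_beat_of_empty hbi hsmall h hbeat
    rw [if_neg hte] at h
    set S := gnodeQ (headLevQ fam) (budsOf M (aggOf M fam) fam) with hS
    by_cases hg : (S.ok && decide ((aggOf M fam).gs * K + S.bud * (tabGQ (headLevQ fam)).get S.idx ≤ M * D * K)) =
        true
    · rw [Bool.and_eq_true, decide_eq_true_eq] at hg
      by_cases hf : fam = []
      · subst hf
        rw [budsOf_nil] at hS
        have : S.ok = false := by rw [hS]; rfl
        rw [this] at hg; exact Bool.false_ne_true hg.1
      · have hsel := gnodeQ_spec (headLevQ fam) (budsOf M (aggOf M fam) fam) hg.1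
        exact hG.not_beat_of_G hsel (hL hf) hg.2 hbeat
    rw [if_neg hg] at h
    -- the tail budget and the level cap
    have hq : ∀ G', AboveQ M G' fam → ((G' - famT fam).map uu).sum ≤ qOfS M (aggOf M fam) fam :=
      fun G' hG' => hG'.tail_uu_le_qOfS
    have hlc : ∀ G', AboveQ M G' fam → ∀ x ∈ G' - famT fam, levTQ x < lcapS (qOfS M (aggOf M fam) fam) ((aggOf M fam).vl M) := by
      intro G' hG' x hx
      have hU := hG'.univ x (mem_G_of_tail hx)
      have ux : uu x ≤ ((G' - famT fam).map uu).sum := Multiset.le_sum_of_mem (Multiset.mem_map_of_mem uu hx)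
      obtain ⟨v1, v2, v3, v4⟩ := hG'.tail_vol hx
      refine levTQ_lt_lcapS hM hU (ux.trans (hq G' hG')) ?_
      unfold Agg.vl Agg.mc aggOf
      simp only
      have hm : max (max (sab fam) (max (sbc fam) (sca fam))) (mxP fam) ≤ M - vol x :=
        max_le (max_le (by omega) (max_le (by omega) (by omega))) (by omega)
      omega
    generalize hqd : qOfS M (aggOf M fam) fam = q at h hq hlc
    generalize hlb : breakLevQ ((aggOf M fam).gs * K) q (selOf ((aggOf M fam).kOf M)) (M * D * K)
      S.ok S.bud S.idx = lb1 at h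
    generalize hlcd : lcapS q ((aggOf M fam).vl M) = lc at h hlc
    generalize hcl : ((fam.isEmpty || decide ((aggOf M fam).gs * K + selOf ((aggOf M fam).kOf M) (tabRQ loLev) *
      q ≤ M * D * K)) || clAnyQ (budsOf M (aggOf M fam) fam) ((aggOf M fam).gs * K) (M * D * K) loLev)
      = cl at h
    refine loopKG_sound (fun fam' B' => dfsKG_sound hM n fam' B') hwf hM hq ?_ hlc ?_ B hP hB h G hG hK hW hbeat hpool
    · intro h0
      obtain ⟨hlo, hc⟩ := breakLevQ_spec hlb h0
      refine ⟨hlo, ?_⟩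
      rcases hc with hc | ⟨hok, hc⟩
      · left; rw [selOf_eq] at hc; exact hc
      · exact Or.inr ⟨S.idx, S.bud, gnodeQ_spec _ _ hok, hc⟩
    · intro hc
      rw [← hcl] at hc
      simp only [Bool.or_eq_true, decide_eq_true_eq] at hc
      rcases hc with (hc | hc) | hc
      · exact Or.inl (List.isEmpty_iff.mp hc)
      · right; left; rw [selOf_eq] at hc; exact hc
      · obtain ⟨i, b, hbi, hle⟩ := clAnyQ_spec hc
        exact Or.inr (Or.inr ⟨i, b, hbi, hle⟩)

/-- **Soundness of the checker `checkQKG`.** If `checkQKG M` succeeds (`M ≤ 489`), no shape multiset inside the universe that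
satisfies the vM system, rule U11-G (credit form), the E3⁺ condition, the E3K condition and rule U11-G′ (credit form) has integer gain
above `10⁶·M`. -/
theorem checkQKG_sound {M : ℕ} (h : checkQKG M = true) (hM : M ≤ 489) (G : Multiset (ℕ × ℕ × ℕ))
    (hU : ∀ x ∈ G, InUniv M x) (hA : AdmM M G) (hG : AdmG M G) (hE : AdmE M G) (hKa : AdmK M G) (hWa : AdmGW M G) :
    ¬ M * D < gsumQ G := by
  intro hbeat
  rw [checkQKG, seqL_eq] at h
  have hP : PoolOKQ M (candBQ M).flatten := by
    rw [candBQ_flatten]; exact ⟨candQ_wf M, candQ_inUniv M, candQ_sorted M⟩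
  refine dfsKG_sound hM (M + 2) [] (candBQ M) (fun _ h => by simp at h) hP (candBQ_const M) (fun h => absurd rfl h) h G
    ⟨hM, hU, hA, hG, hE, fun _ h => by simp at h, by simp [famT]⟩ hKa hWa hbeat ?_
  intro x hx
  have hxG : x ∈ G := Multiset.mem_of_le (Multiset.sub_le_self _ _) hx
  rw [candBQ_flatten]
  exact Or.inr (shQ_mem_candQ hM (hU x hxG))

end searchKG

end Summit.MatrixMultiplication.MatrixMultiplication.Theorems.ShapeCertVQ
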